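import Mathlib
import HarnessLib
import Literature.MathematicalPhysics.QuantumLattice.HubbardUVWeightJets
import Summits.HubbardSuperconductivity.HubbardSuperconductivity.Theorems.KLProgrammeC4aPPKernelModelWindow

/-!
# Route `KLProgramme` — crux C4a, S3 brick (B4) «(B4)-UMK1», «(B3)-K MODEL WINDOW» part 4: ALL-ORDERS `u`-JETS — `P_M` is `C^∞` (in `u` and jointly), above the shell
# the tail is a cutoff-free Möbius series with `|∂ᵤ^k R_M| ≤ k!/ω_M^{k+1}` for EVERY `k`, and `u ↦ P(e,u)` is `C^∞`

Cell `gate-hubbard-kl`, seat hubbard-kl-k3c3-p1 (g18; row «δμ-flow with klAngularMean constant piece»).  Companion of `…C4aPPKernelModelWindow` (part 1: `P = P_M + R_M`,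
first-order tails), `…ModelWindowSum` (part 2: the model's window sum `= P_M`), `…ModelWindowBubble` (part 3: engine/vertex vocabulary).  The reading jets of stub (C)
go to order `k ≤ 4` in the angle, i.e. to `∂ᵤ^k` of the kernel at the partner level; (B3)'s differentiation under the loop/level integrals
(`…C4aBubbleTubeDerivAll`) wants a JOINTLY smooth kernel.  Here:
* §9.1 `contDiff_ppKernelSummand_u/₂`, **`contDiff_ppWindowKernel_u`**, **`contDiff_ppWindowKernel₂`** (`P_M` is `C^∞` in `u` and jointly in `(e,u)` — a finite sum);
* §9.2 the Möbius factor: `hasDerivAt_inv_pow_I`, **`iteratedDeriv_inv_pow_I`** (`∂ᵤ^k (iω+u)^{−(m+1)} = ∏_{i<k}(−(m+1+i))·(iω+u)^{−(m+1+k)}`), `iteratedDeriv_inv_I`,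
  `norm_prod_neg_succ` (`= k!`), **`norm_iteratedDeriv_inv_I_le`** (`≤ k!/|ω|^{k+1}`), `contDiff_inv_I`, `iteratedDeriv_re_eq` (`Re` commutes with `∂ᵤ^k`);
* §9.3 above the shell (`Λ² < ωₙ²`, both weights `≡ 1`): `re_inv_mul_inv_eq`, **`ppKernelSummand_eq_re_of_shell`** (`sₙ(e,u) = Re[(−iωₙ+e)⁻¹(iωₙ+u)⁻¹]`),
  `iteratedDeriv_ppKernelSummand_of_shell`, **`abs_iteratedDeriv_ppKernelSummand_le_of_shell`** (`|∂ᵤ^k sₙ| ≤ k!/ωₙ^{k+2}`), `…_le_tail`;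
* §9.4 `abs_tsum_shift_le_of_inv_sq` (tail lemma with the majorant only on `n ≥ M`), **`iteratedDeriv_tsum_ppKernelSummand_of_shell`** (termwise `∂ᵤ^k` of the tail series,
  induction on `k` by dominated differentiation), **`contDiff_ppTailKernel_u_of_shell`** (`C^∞`), `iteratedDeriv_ppTailKernel_of_shell` (closed form),
  **`abs_iteratedDeriv_ppTailKernel_le`**: `Λ < ω_M ⟹ |∂ᵤ^k R_M(e,u)| ≤ k!/ω_M^{k+1}` for ALL `k, e, u` (at `M ≥ klEngM₃ β U L` the window edge `ω_M = (2M+1)π/β ≥ 2^11πβL²`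
  is astronomically above the shell and every jet of the tail is below every currency of (C)), and **`contDiff_ppTrueKernel_u`** (`u ↦ P(e,u)` is `C^∞`, via `M := ⌈βΛ⌉`).
Pure real/complex analysis on Literature objects; nothing asserts (C), any engine row, K3, the window or superconductivity.
References: BGM 2006 §2.1 (2.3)–(2.4), §2.4 (2.36) [cite: BenfattoGiulianiMastropietro2006]; Salmhofer 1999 §4.2.4 (4.63), §4.2.5 (4.70)–(4.71) [cite: Salmhofer1999].
-/

noncomputable section

namespace Summit.HubbardSuperconductivity.HubbardSuperconductivity.Theorems.C4a

set_option linter.dupNamespace false -- summit = problem name (single-conjunct summit), D-0017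

open Real Filter Set Finset Complex
open scoped Topology
open Literature.MathematicalPhysics.QuantumLattice Literature.Analysis.SpecialFunctions

/-! ## §9 ALL-ORDERS `u`-JETS: `P_M` is `C^∞`; above the shell the tail is a cutoff-free Möbius series with `|∂ᵤ^k R_M| ≤ k!/ω_M^{k+1}` -/

section Jets

/-! ### §9.1 Smoothness of the summands and of the window kernel -/

/-- Each summand of `P` is `C^∞` in the partner level. [cite: Salmhofer1999, §4.2.5 (4.70)] -/
theorem contDiff_ppKernelSummand_u {β : ℝ} (hβ : 0 < β) (Λ e : ℝ) (n : ℕ) {N : ℕ∞} :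
    ContDiff ℝ N (fun u : ℝ => ppKernelSummand β Λ e u n) := by
  have hω := ppFreq_pos hβ n
  have hW : ContDiff ℝ N (fun u : ℝ => uvWeightFn Λ (ppFreq β n) u) := contDiff_uvWeightFn_band Λ (ppFreq β n)
  have hne : ∀ u : ℝ, (ppFreq β n ^ 2 + e ^ 2) * (ppFreq β n ^ 2 + u ^ 2) ≠ 0 := fun u => by positivity
  have hR : ContDiff ℝ N (fun u : ℝ => (e * u + ppFreq β n ^ 2) / ((ppFreq β n ^ 2 + e ^ 2) * (ppFreq β n ^ 2 + u ^ 2))) :=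
    ContDiff.div (by fun_prop) (by fun_prop) hne
  unfold ppKernelSummand
  exact (contDiff_const.mul hW).mul hR

/-- Each summand of `P` is jointly `C^∞` in the two levels. [cite: Salmhofer1999, §4.2.5 (4.70)] -/
theorem contDiff_ppKernelSummand₂ {β : ℝ} (hβ : 0 < β) (Λ : ℝ) (n : ℕ) {N : ℕ∞} :
    ContDiff ℝ N (fun p : ℝ × ℝ => ppKernelSummand β Λ p.1 p.2 n) := by
  have hω := ppFreq_pos hβ n
  have hWe : ContDiff ℝ N (fun p : ℝ × ℝ => uvWeightFn Λ (ppFreq β n) p.1) := (contDiff_uvWeightFn_band Λ (ppFreq β n)).comp contDiff_fst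
  have hWu : ContDiff ℝ N (fun p : ℝ × ℝ => uvWeightFn Λ (ppFreq β n) p.2) := (contDiff_uvWeightFn_band Λ (ppFreq β n)).comp contDiff_snd
  have hne : ∀ p : ℝ × ℝ, (ppFreq β n ^ 2 + p.1 ^ 2) * (ppFreq β n ^ 2 + p.2 ^ 2) ≠ 0 := fun p => by positivity
  have hR : ContDiff ℝ N (fun p : ℝ × ℝ => (p.1 * p.2 + ppFreq β n ^ 2) / ((ppFreq β n ^ 2 + p.1 ^ 2) * (ppFreq β n ^ 2 + p.2 ^ 2))) :=
    ContDiff.div (by fun_prop) (by fun_prop) hne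
  unfold ppKernelSummand
  exact (hWe.mul hWu).mul hR

/-- **`u ↦ P_M(e,u)` is `C^∞`** (finite sum). [cite: BenfattoGiulianiMastropietro2006, §2.1 (2.3)-(2.4)] -/
theorem contDiff_ppWindowKernel_u {β : ℝ} (hβ : 0 < β) (Λ : ℝ) (M : ℕ) (e : ℝ) {N : ℕ∞} :
    ContDiff ℝ N (fun u : ℝ => ppWindowKernel β Λ M e u) := by
  unfold ppWindowKernel
  exact contDiff_const.mul (ContDiff.sum fun n _ => contDiff_ppKernelSummand_u hβ Λ e n)

/-- **`(e,u) ↦ P_M(e,u)` is jointly `C^∞`** — the model kernel may be differentiated under every loop/level integral of (B3) at every order.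
[cite: BenfattoGiulianiMastropietro2006, §2.1 (2.3)-(2.4)] -/
theorem contDiff_ppWindowKernel₂ {β : ℝ} (hβ : 0 < β) (Λ : ℝ) (M : ℕ) {N : ℕ∞} :
    ContDiff ℝ N (fun p : ℝ × ℝ => ppWindowKernel β Λ M p.1 p.2) := by
  unfold ppWindowKernel
  exact contDiff_const.mul (ContDiff.sum fun n _ => contDiff_ppKernelSummand₂ hβ Λ n)

/-! ### §9.2 The Möbius factor `(iω + u)⁻¹` and its jets -/

/-- `iω + u ≠ 0` for real `u`, `ω ≠ 0`. [folklore] -/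
theorem I_mul_add_ofReal_ne_zero {ω : ℝ} (hω : ω ≠ 0) (u : ℝ) : (I * ω + (u : ℂ)) ≠ 0 := by
  intro h
  have := congrArg Complex.im h
  simp at this
  exact hω this

/-- `‖(iω + u)⁻¹‖ ≤ 1/|ω|`. [folklore] -/
theorem norm_inv_I_mul_add_le {ω : ℝ} (hω : ω ≠ 0) (u : ℝ) : ‖(I * ω + (u : ℂ))⁻¹‖ ≤ 1 / |ω| := by
  rw [norm_inv, inv_eq_one_div]
  refine one_div_le_one_div_of_le (abs_pos.2 hω) ?_
  have h := Complex.abs_im_le_norm (I * ω + (u : ℂ))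
  simpa using h

/-- `‖(−iω + e)⁻¹‖ ≤ 1/|ω|`. [folklore] -/
theorem norm_inv_neg_I_mul_add_le {ω : ℝ} (hω : ω ≠ 0) (e : ℝ) : ‖(-I * ω + (e : ℂ))⁻¹‖ ≤ 1 / |ω| := by
  have h := norm_inv_I_mul_add_le (neg_ne_zero.2 hω) e
  rw [abs_neg] at h
  convert h using 3
  push_cast
  ring

/-- `d/du (iω + u)^{−(m+1)} = −(m+1)(iω + u)^{−(m+2)}`. [folklore] -/
theorem hasDerivAt_inv_pow_I {ω : ℝ} (hω : ω ≠ 0) (m : ℕ) (u : ℝ) :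
    HasDerivAt (fun v : ℝ => ((I * ω + (v : ℂ))⁻¹) ^ (m + 1)) (-((m + 1 : ℕ) : ℂ) * ((I * ω + (u : ℂ))⁻¹) ^ (m + 2)) u := by
  have hne := I_mul_add_ofReal_ne_zero hω u
  have h1 : HasDerivAt (fun w : ℂ => I * ω + w) 1 (u : ℂ) := (hasDerivAt_id _).const_add _
  have h2 := (h1.fun_inv hne).fun_pow (m + 1)
  have h3 : HasDerivAt (fun v : ℝ => ((I * ω + (v : ℂ))⁻¹) ^ (m + 1))
      (((m + 1 : ℕ) : ℂ) * ((I * ω + (u : ℂ))⁻¹) ^ (m + 1 - 1) * (-(1 : ℂ) / (I * ω + (u : ℂ)) ^ 2)) u := h2.comp_ofReal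
  rw [Nat.add_sub_cancel] at h3
  refine h3.congr_deriv ?_
  rw [neg_div, one_div, ← inv_pow]
  ring

/-- `∂ᵤ^k (iω + u)^{−(m+1)} = ∏_{i<k}(−(m+1+i))·(iω + u)^{−(m+1+k)}`. [folklore] -/
theorem iteratedDeriv_inv_pow_I {ω : ℝ} (hω : ω ≠ 0) (k : ℕ) : ∀ m : ℕ,
    iteratedDeriv k (fun v : ℝ => ((I * ω + (v : ℂ))⁻¹) ^ (m + 1)) =
      fun u : ℝ => (∏ i ∈ Finset.range k, (-((m + 1 + i : ℕ) : ℂ))) * ((I * ω + (u : ℂ))⁻¹) ^ (m + 1 + k) := by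
  induction k with
  | zero => intro m; funext u; simp
  | succ k ih =>
    intro m
    rw [iteratedDeriv_succ']
    have hd : deriv (fun v : ℝ => ((I * ω + (v : ℂ))⁻¹) ^ (m + 1)) = fun v : ℝ => (-((m + 1 : ℕ) : ℂ)) * ((I * ω + (v : ℂ))⁻¹) ^ (m + 1 + 1) :=
      funext fun v => (hasDerivAt_inv_pow_I hω m v).deriv
    rw [hd]
    funext u
    rw [iteratedDeriv_const_mul_field, ih (m + 1), Finset.prod_range_succ']
    have hc : ∀ i ∈ Finset.range k, (-((m + 1 + 1 + i : ℕ) : ℂ)) = -((m + 1 + (i + 1) : ℕ) : ℂ) := fun i _ => by push_cast; ring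
    rw [Finset.prod_congr rfl hc]
    push_cast
    ring

/-- The order-zero Möbius factor: `∂ᵤ^k (iω + u)⁻¹ = ∏_{i<k}(−(1+i))·(iω + u)^{−(k+1)}`. [folklore] -/
theorem iteratedDeriv_inv_I {ω : ℝ} (hω : ω ≠ 0) (k : ℕ) (u : ℝ) :
    iteratedDeriv k (fun v : ℝ => (I * ω + (v : ℂ))⁻¹) u = (∏ i ∈ Finset.range k, (-((0 + 1 + i : ℕ) : ℂ))) * ((I * ω + (u : ℂ))⁻¹) ^ (0 + 1 + k) := by
  have h := congrFun (iteratedDeriv_inv_pow_I hω k 0) u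
  simpa only [zero_add, pow_one] using h

/-- `‖∏_{i<k}(−(1+i))‖ = k!`. [folklore] -/
theorem norm_prod_neg_succ (k : ℕ) : ‖∏ i ∈ Finset.range k, (-((0 + 1 + i : ℕ) : ℂ))‖ = (k.factorial : ℝ) := by
  rw [norm_prod]
  have h : ∀ i ∈ Finset.range k, ‖(-((0 + 1 + i : ℕ) : ℂ))‖ = ((i + 1 : ℕ) : ℝ) := fun i _ => by
    rw [norm_neg, Complex.norm_natCast]; push_cast; ring
  rw [Finset.prod_congr rfl h, ← Nat.cast_prod, Finset.prod_range_add_one_eq_factorial]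

/-- **`|∂ᵤ^k (iω + u)⁻¹| ≤ k!/|ω|^{k+1}`**. [folklore] -/
theorem norm_iteratedDeriv_inv_I_le {ω : ℝ} (hω : ω ≠ 0) (k : ℕ) (u : ℝ) :
    ‖iteratedDeriv k (fun v : ℝ => (I * ω + (v : ℂ))⁻¹) u‖ ≤ (k.factorial : ℝ) * (1 / |ω|) ^ (k + 1) := by
  rw [iteratedDeriv_inv_I hω, norm_mul, norm_prod_neg_succ, norm_pow, zero_add, add_comm 1 k]
  exact mul_le_mul_of_nonneg_left (pow_le_pow_left₀ (norm_nonneg _) (norm_inv_I_mul_add_le hω u) _) (Nat.cast_nonneg _)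

/-- `u ↦ (iω + u)⁻¹` is `C^∞`. [folklore] -/
theorem contDiff_inv_I {ω : ℝ} (hω : ω ≠ 0) {N : ℕ∞} : ContDiff ℝ N (fun v : ℝ => (I * ω + (v : ℂ))⁻¹) := by
  have haff : ContDiff ℝ N (fun v : ℝ => I * ω + (v : ℂ)) := by
    have : (fun v : ℝ => I * ω + (v : ℂ)) = fun v => I * ω + Complex.ofRealCLM v := by funext v; simp
    rw [this]; exact contDiff_const.add Complex.ofRealCLM.contDiff
  refine contDiff_iff_contDiffAt.2 fun v => ?_
  exact ((contDiffAt_inv ℂ (I_mul_add_ofReal_ne_zero hω v)).restrict_scalars ℝ).comp v haff.contDiffAt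

/-- Taking the real part commutes with `∂ᵤ^k` for a `C^k` complex-valued function of a real variable. [folklore] -/
theorem iteratedDeriv_re_eq {G : ℝ → ℂ} {k : ℕ} {N : ℕ∞} (hG : ContDiff ℝ N G) (hk : (k : ℕ∞) ≤ N) (x : ℝ) :
    iteratedDeriv k (fun u => (G u).re) x = (iteratedDeriv k G x).re := by
  have hfun : (fun u => (G u).re) = Complex.reCLM ∘ G := by funext u; simp
  rw [iteratedDeriv_eq_iteratedFDeriv, iteratedDeriv_eq_iteratedFDeriv, hfun,
    Complex.reCLM.iteratedFDeriv_comp_left (hG.contDiffAt) (by exact_mod_cast hk)]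
  simp

/-! ### §9.3 Above the shell the summand is the real part of a Möbius product -/

/-- `ωₙ` is monotone in `n`. [folklore] -/
theorem ppFreq_mono {β : ℝ} (hβ : 0 < β) {M n : ℕ} (h : M ≤ n) : ppFreq β M ≤ ppFreq β n := by
  unfold ppFreq
  rw [div_le_div_iff_of_pos_right hβ]
  have : (M : ℝ) ≤ (n : ℝ) := by exact_mod_cast h
  nlinarith [Real.pi_pos]

/-- `Re[(−iω + e)⁻¹(iω + u)⁻¹] = (eu + ω²)/((ω²+e²)(ω²+u²))`. [folklore] -/
theorem re_inv_mul_inv_eq (ω e u : ℝ) :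
    ((-I * ω + (e : ℂ))⁻¹ * (I * ω + (u : ℂ))⁻¹).re = (e * u + ω ^ 2) / ((ω ^ 2 + e ^ 2) * (ω ^ 2 + u ^ 2)) := by
  rw [← mul_inv, Complex.inv_re, Complex.normSq_mul]
  have h1 : Complex.normSq (-I * ω + (e : ℂ)) = ω ^ 2 + e ^ 2 := by rw [Complex.normSq_apply]; simp; ring
  have h2 : Complex.normSq (I * ω + (u : ℂ)) = ω ^ 2 + u ^ 2 := by rw [Complex.normSq_apply]; simp; ring
  have h3 : ((-I * ω + (e : ℂ)) * (I * ω + (u : ℂ))).re = e * u + ω ^ 2 := by simp; ring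
  rw [h1, h2, h3]

/-- **Above the shell** (`Λ² < ωₙ²`) both weights are `1` and the summand is `Re[(−iωₙ + e)⁻¹(iωₙ + u)⁻¹]`. [cite: Salmhofer1999, §4.2.5 (4.71)] -/
theorem ppKernelSummand_eq_re_of_shell {β Λ : ℝ} (hβ : 0 < β) (hΛ : 0 < Λ) {n : ℕ} (hn : Λ ^ 2 < ppFreq β n ^ 2) (e u : ℝ) :
    ppKernelSummand β Λ e u n = ((-I * ppFreq β n + (e : ℂ))⁻¹ * (I * ppFreq β n + (u : ℂ))⁻¹).re := by
  have hω := ppFreq_pos hβ n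
  have hWe : uvWeightFn Λ (ppFreq β n) e = 1 := (uvWeightFn_eq_one_of_gt hΛ (e := ppFreq β n) (ω := e) (by nlinarith [sq_nonneg e])).1
  have hWu : uvWeightFn Λ (ppFreq β n) u = 1 := (uvWeightFn_eq_one_of_gt hΛ (e := ppFreq β n) (ω := u) (by nlinarith [sq_nonneg u])).1
  rw [ppKernelSummand, hWe, hWu, one_mul, one_mul, re_inv_mul_inv_eq]

/-- **The `k`-th `u`-jet of a summand above the shell**: `∂ᵤ^k sₙ(e,u) = Re[(−iωₙ+e)⁻¹·∏_{i<k}(−(1+i))·(iωₙ+u)^{−(k+1)}]`. [folklore] -/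
theorem iteratedDeriv_ppKernelSummand_of_shell {β Λ : ℝ} (hβ : 0 < β) (hΛ : 0 < Λ) {n : ℕ} (hn : Λ ^ 2 < ppFreq β n ^ 2) (e : ℝ) (k : ℕ) (u : ℝ) :
    iteratedDeriv k (fun v : ℝ => ppKernelSummand β Λ e v n) u =
      ((-I * ppFreq β n + (e : ℂ))⁻¹ * ((∏ i ∈ Finset.range k, (-((0 + 1 + i : ℕ) : ℂ))) * ((I * ppFreq β n + (u : ℂ))⁻¹) ^ (0 + 1 + k))).re := by
  have hω := (ppFreq_pos hβ n).ne'
  have hfun : (fun v : ℝ => ppKernelSummand β Λ e v n) = fun v : ℝ => ((-I * ppFreq β n + (e : ℂ))⁻¹ * (I * ppFreq β n + (v : ℂ))⁻¹).re :=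
    funext fun v => ppKernelSummand_eq_re_of_shell hβ hΛ hn e v
  have hG : ContDiff ℝ (k : ℕ∞) (fun v : ℝ => (-I * ppFreq β n + (e : ℂ))⁻¹ * (I * ppFreq β n + (v : ℂ))⁻¹) := contDiff_const.mul (contDiff_inv_I hω)
  rw [hfun, iteratedDeriv_re_eq hG le_rfl, iteratedDeriv_const_mul_field, iteratedDeriv_inv_I hω]

/-- **`|∂ᵤ^k sₙ(e,u)| ≤ k!/ωₙ^{k+2}`** above the shell, for all levels. [folklore] -/
theorem abs_iteratedDeriv_ppKernelSummand_le_of_shell {β Λ : ℝ} (hβ : 0 < β) (hΛ : 0 < Λ) {n : ℕ} (hn : Λ ^ 2 < ppFreq β n ^ 2) (e : ℝ) (k : ℕ) (u : ℝ) :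
    |iteratedDeriv k (fun v : ℝ => ppKernelSummand β Λ e v n) u| ≤ (k.factorial : ℝ) * (1 / ppFreq β n) ^ (k + 2) := by
  have hω := ppFreq_pos hβ n
  rw [iteratedDeriv_ppKernelSummand_of_shell hβ hΛ hn e k u, ← iteratedDeriv_inv_I hω.ne']
  refine (Complex.abs_re_le_norm _).trans ?_
  rw [norm_mul]
  have h1 := norm_inv_neg_I_mul_add_le hω.ne' e
  have h2 := norm_iteratedDeriv_inv_I_le hω.ne' k u
  rw [abs_of_pos hω] at h1 h2
  calc ‖(-I * ppFreq β n + (e : ℂ))⁻¹‖ * ‖iteratedDeriv k (fun v : ℝ => (I * ppFreq β n + (v : ℂ))⁻¹) u‖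
      ≤ (1 / ppFreq β n) * ((k.factorial : ℝ) * (1 / ppFreq β n) ^ (k + 1)) := mul_le_mul h1 h2 (norm_nonneg _) (by positivity)
    _ = (k.factorial : ℝ) * (1 / ppFreq β n) ^ (k + 2) := by ring

/-- The tail-ready form of the jet bound: for `n ≥ M`, `|∂ᵤ^k sₙ| ≤ (k!/ω_M^k)·(1/(ωₙ² + 0²))`. [folklore] -/
theorem abs_iteratedDeriv_ppKernelSummand_le_tail {β Λ : ℝ} (hβ : 0 < β) (hΛ : 0 < Λ) {M : ℕ} (hMΛ : Λ < ppFreq β M) (e : ℝ) (k : ℕ) (u : ℝ) (j : ℕ) :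
    |iteratedDeriv k (fun v : ℝ => ppKernelSummand β Λ e v (j + M)) u| ≤ (k.factorial : ℝ) / ppFreq β M ^ k * (1 / (ppFreq β (j + M) ^ 2 + 0 ^ 2)) := by
  have hωM := ppFreq_pos hβ M
  have hmono : ppFreq β M ≤ ppFreq β (j + M) := ppFreq_mono hβ (Nat.le_add_left M j)
  have hωj : 0 < ppFreq β (j + M) := hωM.trans_le hmono
  have hn : Λ ^ 2 < ppFreq β (j + M) ^ 2 := by nlinarith
  refine (abs_iteratedDeriv_ppKernelSummand_le_of_shell hβ hΛ hn e k u).trans ?_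
  rw [zero_pow two_ne_zero, add_zero, show (1 / ppFreq β (j + M)) ^ (k + 2) = (1 / ppFreq β (j + M)) ^ k * (1 / ppFreq β (j + M) ^ 2) by
    rw [pow_add]; field_simp]
  have hk : (1 / ppFreq β (j + M)) ^ k ≤ (1 / ppFreq β M) ^ k :=
    pow_le_pow_left₀ (by positivity) (one_div_le_one_div_of_le hωM hmono) k
  calc (k.factorial : ℝ) * ((1 / ppFreq β (j + M)) ^ k * (1 / ppFreq β (j + M) ^ 2))
      ≤ (k.factorial : ℝ) * ((1 / ppFreq β M) ^ k * (1 / ppFreq β (j + M) ^ 2)) := by gcongr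
    _ = (k.factorial : ℝ) / ppFreq β M ^ k * (1 / (ppFreq β (j + M) ^ 2)) := by rw [one_div_pow]; ring

/-! ### §9.4 The tail's jets: termwise differentiation at every order and the count-free bound -/

/-- Shifted-tail variant of `abs_tsum_tail_le_of_inv_sq`: the majorant is only required on `n ≥ M`. [cite: BenfattoGiulianiMastropietro2006, §2.1 (2.3)-(2.4)] -/
theorem abs_tsum_shift_le_of_inv_sq {β : ℝ} (hβ : 0 < β) {C : ℝ} (hC : 0 ≤ C) {a : ℕ → ℝ} (M : ℕ)
    (ha : ∀ j, |a (j + M)| ≤ C * (1 / (ppFreq β (j + M) ^ 2 + 0 ^ 2))) :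
    |∑' j : ℕ, a (j + M)| ≤ C * (β / (2 * ppFreq β M)) := by
  have hωM := ppFreq_pos hβ M
  set g : ℕ → ℝ := fun n => 2 * C * (1 / (ppFreq β n ^ 2 + ppFreq β M ^ 2)) with hg
  have hg0 : ∀ n, 0 ≤ g n := fun n => by positivity
  have hsg : Summable g := (summable_one_div_ppFreq_sq_add_sq hβ (ppFreq β M)).mul_left _
  have hbd : ∀ j : ℕ, |a (j + M)| ≤ g (j + M) := fun j => by
    refine (ha j).trans ?_
    calc C * (1 / (ppFreq β (j + M) ^ 2 + 0 ^ 2)) ≤ C * (2 * (1 / (ppFreq β (j + M) ^ 2 + ppFreq β M ^ 2))) :=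
          mul_le_mul_of_nonneg_left (ppFreq_tail_majorant hβ 0 M j) hC
      _ = g (j + M) := by simp only [hg]; ring
  have hsgs : Summable fun j : ℕ => g (j + M) := (summable_nat_add_iff M).2 hsg
  have hsf : Summable fun j : ℕ => a (j + M) := Summable.of_norm_bounded hsgs fun j => by rw [Real.norm_eq_abs]; exact hbd j
  have htail : ∑' j : ℕ, g (j + M) ≤ ∑' n : ℕ, g n := by
    rw [← hsg.sum_add_tsum_nat_add M]
    have : 0 ≤ ∑ n ∈ Finset.range M, g n := Finset.sum_nonneg fun n _ => hg0 n
    linarith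
  have hfull : ∑' n : ℕ, g n = 2 * C * (β * Real.tanh (β * ppFreq β M / 2) / (4 * ppFreq β M)) := by
    rw [hg, tsum_mul_left, tsum_one_div_ppFreq_sq_add_sq hβ hωM.ne']
  have ht : Real.tanh (β * ppFreq β M / 2) ≤ 1 := (Real.tanh_lt_one _).le
  calc |∑' j : ℕ, a (j + M)| ≤ ∑' j : ℕ, |a (j + M)| := by
        have := norm_tsum_le_tsum_norm hsf.norm; simpa only [Real.norm_eq_abs] using this
    _ ≤ ∑' j : ℕ, g (j + M) := Summable.tsum_le_tsum hbd (by simpa only [Real.norm_eq_abs] using hsf.norm) hsgs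
    _ ≤ ∑' n : ℕ, g n := htail
    _ = 2 * C * (β * Real.tanh (β * ppFreq β M / 2) / (4 * ppFreq β M)) := hfull
    _ ≤ 2 * C * (β * 1 / (4 * ppFreq β M)) := by gcongr
    _ = C * (β / (2 * ppFreq β M)) := by field_simp; ring

/-- **TERMWISE JETS OF THE TAIL ABOVE THE SHELL**: for `Λ < ω_M` and every `k`,
`∂ᵤ^k (Σ_{j} s_{j+M}(e,·)) = Σ_{j} ∂ᵤ^k s_{j+M}(e,·)` (dominated termwise differentiation, by induction on `k`). [cite: BenfattoGiulianiMastropietro2006, §2.1 (2.3)-(2.4)] -/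
theorem iteratedDeriv_tsum_ppKernelSummand_of_shell {β Λ : ℝ} (hβ : 0 < β) (hΛ : 0 < Λ) {M : ℕ} (hMΛ : Λ < ppFreq β M) (e : ℝ) (k : ℕ) :
    iteratedDeriv k (fun v : ℝ => ∑' j : ℕ, ppKernelSummand β Λ e v (j + M)) =
      fun u => ∑' j : ℕ, iteratedDeriv k (fun v : ℝ => ppKernelSummand β Λ e v (j + M)) u := by
  have hωM := ppFreq_pos hβ M
  induction k with
  | zero => funext u; simp
  | succ k ih =>
    rw [iteratedDeriv_succ, ih]
    funext u
    -- dominated differentiation of the series of the `k`-th jets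
    have hdiff : ∀ j, Differentiable ℝ (iteratedDeriv k (fun v : ℝ => ppKernelSummand β Λ e v (j + M))) := fun j =>
      (contDiff_ppKernelSummand_u hβ Λ e (j + M) (N := ((k + 1 : ℕ) : ℕ∞))).differentiable_iteratedDeriv' k
    have hbd : ∀ j y, ‖deriv (iteratedDeriv k (fun v : ℝ => ppKernelSummand β Λ e v (j + M))) y‖ ≤
        ((k + 1).factorial : ℝ) / ppFreq β M ^ (k + 1) * (1 / (ppFreq β (j + M) ^ 2 + 0 ^ 2)) := fun j y => by
      rw [← iteratedDeriv_succ, Real.norm_eq_abs]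
      exact abs_iteratedDeriv_ppKernelSummand_le_tail hβ hΛ hMΛ e (k + 1) y j
    have hsum : Summable fun j => ((k + 1).factorial : ℝ) / ppFreq β M ^ (k + 1) * (1 / (ppFreq β (j + M) ^ 2 + 0 ^ 2)) :=
      ((summable_nat_add_iff M).2 (summable_one_div_ppFreq_sq_add_sq hβ 0)).mul_left _
    have h0 : Summable fun j => iteratedDeriv k (fun v : ℝ => ppKernelSummand β Λ e v (j + M)) u :=
      Summable.of_norm_bounded (((summable_nat_add_iff M).2 (summable_one_div_ppFreq_sq_add_sq hβ 0)).mul_left ((k.factorial : ℝ) / ppFreq β M ^ k))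
        fun j => by rw [Real.norm_eq_abs]; exact abs_iteratedDeriv_ppKernelSummand_le_tail hβ hΛ hMΛ e k u j
    rw [deriv_tsum_apply hsum hdiff hbd h0 u]
    exact tsum_congr fun j => by rw [iteratedDeriv_succ]

/-- **`u ↦ R_M(e,u)` IS `C^∞` ABOVE THE SHELL** (`Λ < ω_M`). [cite: BenfattoGiulianiMastropietro2006, §2.1 (2.3)-(2.4)] -/
theorem contDiff_ppTailKernel_u_of_shell {β Λ : ℝ} (hβ : 0 < β) (hΛ : 0 < Λ) {M : ℕ} (hMΛ : Λ < ppFreq β M) (e : ℝ) {N : ℕ∞} :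
    ContDiff ℝ N (fun u : ℝ => ppTailKernel β Λ M e u) := by
  have hωM := ppFreq_pos hβ M
  unfold ppTailKernel
  refine contDiff_const.mul ?_
  refine contDiff_tsum (N := N) (fun j => contDiff_ppKernelSummand_u hβ Λ e (j + M))
    (v := fun k j => (k.factorial : ℝ) / ppFreq β M ^ k * (1 / (ppFreq β (j + M) ^ 2 + 0 ^ 2)))
    (fun k _ => ((summable_nat_add_iff M).2 (summable_one_div_ppFreq_sq_add_sq hβ 0)).mul_left _) fun k j x _ => ?_
  rw [norm_iteratedFDeriv_eq_norm_iteratedDeriv, Real.norm_eq_abs]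
  exact abs_iteratedDeriv_ppKernelSummand_le_tail hβ hΛ hMΛ e k x j

/-- **THE TAIL'S `k`-TH JET, TERMWISE**: `∂ᵤ^k R_M(e,u) = (2/β)·Σ_{j} Re[(−iω_{j+M}+e)⁻¹·∏_{i<k}(−(1+i))·(iω_{j+M}+u)^{−(k+1)}]` (`Λ < ω_M`).
[cite: BenfattoGiulianiMastropietro2006, §2.1 (2.3)-(2.4)] -/
theorem iteratedDeriv_ppTailKernel_of_shell {β Λ : ℝ} (hβ : 0 < β) (hΛ : 0 < Λ) {M : ℕ} (hMΛ : Λ < ppFreq β M) (e : ℝ) (k : ℕ) (u : ℝ) :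
    iteratedDeriv k (fun v : ℝ => ppTailKernel β Λ M e v) u =
      2 / β * ∑' j : ℕ, ((-I * ppFreq β (j + M) + (e : ℂ))⁻¹ *
        ((∏ i ∈ Finset.range k, (-((0 + 1 + i : ℕ) : ℂ))) * ((I * ppFreq β (j + M) + (u : ℂ))⁻¹) ^ (0 + 1 + k))).re := by
  have hωM := ppFreq_pos hβ M
  unfold ppTailKernel
  rw [iteratedDeriv_const_mul_field, iteratedDeriv_tsum_ppKernelSummand_of_shell hβ hΛ hMΛ e k]
  congr 1
  refine tsum_congr fun j => ?_
  have hn : Λ ^ 2 < ppFreq β (j + M) ^ 2 := by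
    have hmono := ppFreq_mono hβ (Nat.le_add_left M j); nlinarith
  exact iteratedDeriv_ppKernelSummand_of_shell hβ hΛ hn e k u

/-- **THE TAIL'S JETS ARE COUNT-FREE SMALL AT EVERY ORDER**: `|∂ᵤ^k R_M(e,u)| ≤ k!/ω_M^{k+1}` for all `k`, all levels (`Λ < ω_M`, `ω_M = (2M+1)π/β`) — the
`k ≤ 4` reading jets of the MODEL kernel `P_M = P − R_M` see the Matsubara window only through terms below every currency of (C).
[cite: BenfattoGiulianiMastropietro2006, §2.1 (2.3)-(2.4)] -/
theorem abs_iteratedDeriv_ppTailKernel_le {β Λ : ℝ} (hβ : 0 < β) (hΛ : 0 < Λ) {M : ℕ} (hMΛ : Λ < ppFreq β M) (e : ℝ) (k : ℕ) (u : ℝ) :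
    |iteratedDeriv k (fun v : ℝ => ppTailKernel β Λ M e v) u| ≤ (k.factorial : ℝ) / ppFreq β M ^ (k + 1) := by
  have hωM := ppFreq_pos hβ M
  have hsplit : iteratedDeriv k (fun v : ℝ => ppTailKernel β Λ M e v) u = 2 / β * ∑' j : ℕ, iteratedDeriv k (fun v : ℝ => ppKernelSummand β Λ e v (j + M)) u := by
    unfold ppTailKernel
    rw [iteratedDeriv_const_mul_field, iteratedDeriv_tsum_ppKernelSummand_of_shell hβ hΛ hMΛ e k]
  have htail := abs_tsum_shift_le_of_inv_sq hβ (C := (k.factorial : ℝ) / ppFreq β M ^ k) (by positivity)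
    (a := fun n => iteratedDeriv k (fun v : ℝ => ppKernelSummand β Λ e v n) u) M
    (fun j => abs_iteratedDeriv_ppKernelSummand_le_tail hβ hΛ hMΛ e k u j)
  have hβ2 : 0 < 2 / β := by positivity
  rw [hsplit, abs_mul, abs_of_pos hβ2]
  calc 2 / β * |∑' j : ℕ, iteratedDeriv k (fun v : ℝ => ppKernelSummand β Λ e v (j + M)) u|
      ≤ 2 / β * ((k.factorial : ℝ) / ppFreq β M ^ k * (β / (2 * ppFreq β M))) := mul_le_mul_of_nonneg_left htail hβ2.le
    _ = (k.factorial : ℝ) / ppFreq β M ^ (k + 1) := by field_simp; ring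

/-- **`u ↦ P(e,u)` IS `C^∞`** (`P = P_M + R_M` with `M := ⌈βΛ⌉`, whose window edge lies above the shell) — upgrades `contDiff_one_ppTrueKernel` /
`contDiff_two_ppTrueKernel_u` to every order. [cite: BenfattoGiulianiMastropietro2006, §2.1 (2.3)-(2.4)] -/
theorem contDiff_ppTrueKernel_u {β Λ : ℝ} (hβ : 0 < β) (hΛ : 0 < Λ) (e : ℝ) {N : ℕ∞} : ContDiff ℝ N (fun u : ℝ => ppTrueKernel β Λ e u) := by
  set M : ℕ := ⌈β * Λ⌉₊ with hM
  have hMΛ : Λ < ppFreq β M := by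
    unfold ppFreq
    rw [lt_div_iff₀ hβ]
    have h1 : β * Λ ≤ (M : ℝ) := Nat.le_ceil _
    have hπ : 3 < π := Real.pi_gt_three
    nlinarith [mul_pos hβ hΛ]
  have hfun : (fun u : ℝ => ppTrueKernel β Λ e u) = fun u => ppWindowKernel β Λ M e u + ppTailKernel β Λ M e u :=
    funext fun u => ppTrueKernel_eq_window_add_tail hβ Λ M e u
  rw [hfun]
  exact (contDiff_ppWindowKernel_u hβ Λ M e).add (contDiff_ppTailKernel_u_of_shell hβ hΛ hMΛ e)

end Jets

end Summit.HubbardSuperconductivity.HubbardSuperconductivity.Theorems.C4a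

end
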